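import Mathlib
import Summits.Ventures.HodgeRepro2.T6N42FlathLift
import Summits.Ventures.HodgeRepro2.T6N42FlathLiftRead
import Summits.Ventures.HodgeRepro2.T6N42Toy

/-!
# T6N42FlathLiftToy — non-vacuity of the `hFL` interface of `T6N42FlathLift.lean` (§10.5(ii)(c)/(d))
(owner t6-p5)

`ReadAtPlace.self` (every global lift datum reads at «the whole» with trivial away data) with its
laws `ReadAtPlace.self_isReading`, `toyGlobal` (the toy tower's data with the toy first lift
`x ↦ x ⊗ 1` as theta map, from `T6N42Toy.toyTower_firstLift`) with `toyGlobal_isLift`,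
`toyFirstLiftReading : FirstLiftReading toyFinitePlaces` with `toyFirstLiftReading_isReading`, and
`toyFinitePlaces_firstLift_read : toyFinitePlaces.FirstLift` — the toy datum's `FirstLift`
re-derived through the interface (`FirstLiftReading.firstLift`), so the structures
`GlobalLiftDatum` / `ReadAtPlace` / `FirstLiftReading` are inhabited WITH their laws and the bridge
fires.

README §8(d): uses an L-value-free non-vanishing device: NO (TIER5 §N4.2 / §B, pre-02:16Z lines of
record, continued).

Filed in Tier-6 WAVE 1 as p438108 (proposed 2026-08-26T10:29:15Z, ACCEPTED, commit dc3b8a4d5a10);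
this v2 differs from the filed bytes in this module docstring only (the staged-record wording
dropped; every declaration byte-identical to v1).
-/

namespace Summit.Ventures.HodgeRepro2.T6.N42Flath

open Summit.Ventures.HodgeRepro2
open Summit.Ventures.HodgeRepro2.T5DualPairSwap
open Summit.Ventures.HodgeRepro2.T5SplittingTwist
open Summit.Ventures.HodgeRepro2.T5TrivialPartner
open Summit.Ventures.HodgeRepro2.T6.N42Defs
open Summit.Ventures.HodgeRepro2.T6.N42Datum
open TensorProduct

section Toy

/-- The reading of a global datum at «the whole» (trivial away data, `ι` the projection
`(G(𝔸) × H(𝔸)) × 1 ≅ G(𝔸) × H(𝔸)`, `eΩ` / `ePi` the inverses of `TensorProduct.rid`): every global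
datum reads at the trivial place. Non-vacuity of `ReadAtPlace`. -/
noncomputable def ReadAtPlace.self (Gl : GlobalLiftDatum) :
    ReadAtPlace Gl Gl.ωA Gl.πA (charLinRep Gl.βA) where
  G' := Unit
  A₂ := ℂ
  ω' := Representation.trivial ℂ Unit ℂ
  B₂ := ℂ
  τ₂ := Representation.trivial ℂ Unit ℂ
  ι := MulEquiv.prodUnique
  eΩ := (TensorProduct.rid ℂ Gl.Ω).symm
  ePi := (TensorProduct.rid ℂ (Gl.Vπ ⊗[ℂ] ℂ)).symm

/-- … and it is a reading (the two intertwinings hold). -/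
theorem ReadAtPlace.self_isReading (Gl : GlobalLiftDatum) : (ReadAtPlace.self Gl).IsReading where
  eΩ_intertwining := by
    show Representation.IsIntertwiningMap
      (Gl.ωA.comp (MulEquiv.prodUnique : (Gl.GA × Gl.HA) × Unit ≃* Gl.GA × Gl.HA).toMonoidHom)
      (extTprod Gl.ωA (Representation.trivial ℂ Unit ℂ)) (TensorProduct.rid ℂ Gl.Ω).symm.toLinearMap
    refine ⟨fun x u => ?_⟩
    simp [extTprod_apply, TensorProduct.rid_symm_apply, Representation.trivial,
      MulEquiv.prodUnique]
  ePi_intertwining := by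
    show Representation.IsIntertwiningMap
      ((extTprod Gl.πA (charLinRep Gl.βA)).comp
        (MulEquiv.prodUnique : (Gl.GA × Gl.HA) × Unit ≃* Gl.GA × Gl.HA).toMonoidHom)
      (extTprod (extTprod Gl.πA (charLinRep Gl.βA)) (Representation.trivial ℂ Unit ℂ))
      (TensorProduct.rid ℂ (Gl.Vπ ⊗[ℂ] ℂ)).symm.toLinearMap
    refine ⟨fun x u => ?_⟩
    simp [extTprod_apply, TensorProduct.rid_symm_apply, Representation.trivial,
      MulEquiv.prodUnique]

open Summit.Ventures.HodgeRepro2.T6.N42Toy in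
/-- The toy global datum: the toy tower's data with the toy first lift `x ↦ x ⊗ 1` as theta map. -/
noncomputable def toyGlobal : GlobalLiftDatum :=
  GlobalLiftDatum.ofHasPartner (toyTower.ω 0) toyTower.π (1 : Unit →* ℂˣ) toyTower_firstLift

open Summit.Ventures.HodgeRepro2.T6.N42Toy in
/-- … and it is a lift. -/
theorem toyGlobal_isLift : toyGlobal.IsLift :=
  GlobalLiftDatum.isLift_ofHasPartner (toyTower.ω 0) toyTower.π (1 : Unit →* ℂˣ) toyTower_firstLift

open Summit.Ventures.HodgeRepro2.T6.N42Toy in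
/-- The toy datum has a first-lift reading: the toy global datum, read at its one non-split place
as «the whole». -/
noncomputable def toyFirstLiftReading : FirstLiftReading toyFinitePlaces where
  global := toyGlobal
  read := fun _ => ReadAtPlace.self toyGlobal

/-- … and it satisfies the laws. -/
theorem toyFirstLiftReading_isReading : toyFirstLiftReading.IsReading where
  global := toyGlobal_isLift
  read := fun _ => ReadAtPlace.self_isReading toyGlobal

open Summit.Ventures.HodgeRepro2.T6.N42Toy in
/-- The toy datum's `FirstLift`, re-derived through the interface (§10.5(ii)(d) for this file). -/
theorem toyFinitePlaces_firstLift_read : toyFinitePlaces.FirstLift :=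
  toyFirstLiftReading.firstLift toyFirstLiftReading_isReading

end Toy

end Summit.Ventures.HodgeRepro2.T6.N42Flath
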